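/-
Copyright: H21 programme, solo seat `solo-RiemannHypothesis-informed` (session 6).
-/
import Summits.RiemannHypothesis.RiemannHypothesis.Theorems.SoloInformedCombEnergy
import Summits.RiemannHypothesis.RiemannHypothesis.Theorems.SoloInformedTuranVisibility

/-!
# The price of a companion (solo-informed, T39)

**T39** (`companion_window`).  Let `0 < η < ½`, `ζ(½ + η + iγ₀) = 0`, and suppose Weil's
functional is non-negative on tests supported in `[-a, a]` (`weilGroundEnergy a ≥ 0`, `a ≥ 5/2`).
Fix a decay order `q ≥ 2`, a companion allowance `M`, and a tooth parameter `K ≥ 1` with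

* (K2, far zone)   `e^{a} (2L_q/(πK)^{q-2})² ≤ C_χ²`,
* (flatness)       `ε := 2L_q/(π^q K^{q-1}) ≤ 1/4`,
* (K1, Turán)      `2ε · 4π A₁ C_χ² (2J_M+1) log(|γ₀| + πJ_M + 2) ≤ c(M+1, 2a-3)`,
  `J_M = (2M+1)K`, `c = turanConst`,
* `|γ₀| ≥ 2π(M+1)K`.

If the zeros `ρ` of `ζ` with `Re ρ > ½` and `|Im ρ - γ₀| < 2π(M+1)K` (the target and its
*companions* on the right of the line) number at most `M + 1`, then

`η (2a - 3) ≤ log(10π A₁ C_χ² (2J_M+1) log(|γ₀| + πJ_M + 2)) + (M+1) + (M+2) log(250(2a-2))`.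

So each admitted companion costs `log(250(2a-2)) + 1` on top of the double-log window, and
nothing is assumed about *where* in the zone the companions sit.  The contrapositive
(`riemannZeta_ne_zero_of_companions`) is the exclusion statement.  For `M = 0` no Turán step
is needed and the window is the double-log window with the comb constants
(`companion_window_zero`, file `SoloInformedCompanionZero`).

Proof.  Shell pigeonhole: among the `M+1` comb sizes `J_i = (2i+1)K`, `i ≤ M`, one has no
right-of-the-line zero with `2πiK < |Im ρ - γ₀| < 2π(i+1)K`; for it every zone zero is a core
zero, where `|Φ_{J_i}(λ_ρ) - 2| ≤ ε` (`norm_combXform_sub_two_le`).  Then Turán visibility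
(`exists_norm_expSum_ge_of_weights`, weights `m|Φ_ρ|²`, multipliers `Φ_ρ²/|Φ_ρ|²`) gives a
`τ ∈ [2a-3, 2a-2]` with `(3c - 2εS) e^{ητ} ≤ |U(τ)|`, and `|U(τ)| ≤ 20πA₁C_χ²(2J+1)log`
by `norm_combExpSum_le`.
-/

noncomputable section

open Real MeasureTheory Filter Complex Set Literature.NumberTheory.LFunctions
open scoped Topology ContDiff ComplexConjugate

namespace Summit.RiemannHypothesis.RiemannHypothesis.Theorems

open Companion

namespace Companion

/-- **Flat values give near-unit multipliers.**  If `|Φ - 2| ≤ ε ≤ 1/4` then `Φ ≠ 0`,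
`|Φ|² ≥ 3` and `|Φ²/|Φ|² - 1| ≤ 2ε`. -/
theorem flat_multiplier {Φ : ℂ} {ε : ℝ} (hΦ : ‖Φ - 2‖ ≤ ε) (hε : ε ≤ 1 / 4) :
    Φ ≠ 0 ∧ 3 ≤ ‖Φ‖ ^ 2 ∧ ‖Φ ^ 2 / ((‖Φ‖ ^ 2 : ℝ) : ℂ) - 1‖ ≤ 2 * ε := by
  have hn : 7 / 4 ≤ ‖Φ‖ := by
    have := norm_sub_norm_le (2 : ℂ) Φ
    rw [norm_sub_rev] at this
    have h2 : ‖(2 : ℂ)‖ = 2 := by simp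
    linarith
  have hΦ0 : Φ ≠ 0 := by
    intro h; rw [h, norm_zero] at hn; linarith
  have hε0 : 0 ≤ ε := (norm_nonneg _).trans hΦ
  refine ⟨hΦ0, by nlinarith, ?_⟩
  have hnsq : (((‖Φ‖ ^ 2 : ℝ)) : ℂ) = Φ * conj Φ := by
    rw [Complex.mul_conj, Complex.normSq_eq_norm_sq]
  have hcΦ0 : conj Φ ≠ 0 := (map_ne_zero _).mpr hΦ0
  have e : Φ ^ 2 / (((‖Φ‖ ^ 2 : ℝ)) : ℂ) - 1 = (Φ - conj Φ) / conj Φ := by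
    rw [hnsq]; field_simp
  rw [e, norm_div, Complex.norm_conj]
  have hdiff : ‖Φ - conj Φ‖ ≤ 2 * ε := by
    have e2 : Φ - conj Φ = (Φ - 2) - conj (Φ - 2) := by
      simp only [map_sub, map_ofNat]; ring
    rw [e2]
    refine (norm_sub_le _ _).trans ?_
    rw [Complex.norm_conj]; linarith
  rw [div_le_iff₀ (by linarith)]
  nlinarith

/-- **Shell pigeonhole.**  `M` points cannot block all `M+1` shells
`2πiK ≤ |Im ρ - γ₀| < 2π(i+1)K`, `i ≤ M`. -/
theorem exists_free_shell (Q : Finset ℂ) {M : ℕ} (hQ : Q.card ≤ M) (γ₀ : ℝ) {K : ℝ}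
    (hK : 0 < K) :
    ∃ i : ℕ, i ≤ M ∧ ∀ ρ ∈ Q, |ρ.im - γ₀| < 2 * π * i * K ∨ 2 * π * (i + 1) * K ≤ |ρ.im - γ₀| := by
  classical
  have hD : 0 < 2 * π * K := by positivity
  set f : ℂ → ℕ := fun ρ ↦ ⌊|ρ.im - γ₀| / (2 * π * K)⌋₊ with hf
  have hcard : (Q.image f).card < (Finset.range (M + 1)).card := by
    rw [Finset.card_range]
    exact (Finset.card_image_le).trans_lt (by omega)
  obtain ⟨i, hi, hnot⟩ := Finset.exists_mem_notMem_of_card_lt_card hcard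
  refine ⟨i, by simpa [Nat.lt_succ_iff] using hi, fun ρ hρ ↦ ?_⟩
  have hx0 : 0 ≤ |ρ.im - γ₀| / (2 * π * K) := by positivity
  have hne : f ρ ≠ i := fun h ↦ hnot (Finset.mem_image.mpr ⟨ρ, hρ, h⟩)
  by_contra hcon
  obtain ⟨h1, h2⟩ := not_or.mp hcon
  apply hne
  rw [hf, Nat.floor_eq_iff hx0]
  constructor
  · rw [le_div_iff₀ hD]; linarith [not_lt.mp h1]
  · rw [div_lt_iff₀ hD]; linarith [not_le.mp h2]

end Companion

/-- **Zone completeness by reflection.**  If `P` consists exactly of the zeros with `Re ρ > ½`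
and `|Im ρ - γ₀| < R`, `R ≤ |γ₀|`, then every off-line zero of the zone is in `P` or is the
reflection `1 - ρ̄` of a member of `P`. -/
theorem Companion.zone_complete {P : Finset ℂ} {γ₀ R : ℝ} (hR : R ≤ |γ₀|)
    (hmem : ∀ ρ, ρ ∈ P ↔ riemannZeta ρ = 0 ∧ 1 / 2 < ρ.re ∧ |ρ.im - γ₀| < R) :
    ∀ ρ : ℂ, riemannZeta ρ = 0 → 0 ≤ ρ.re → ρ.re ≤ 1 → ρ.re ≠ 1 / 2 →
      |ρ.im - γ₀| < R → ρ ∈ P ∨ 1 - conj ρ ∈ P := by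
  intro ρ hz _ _ hne hnear
  rcases lt_or_gt_of_ne hne with hlt | hgt
  · right
    rw [hmem]
    have him : (1 - conj ρ : ℂ).im = ρ.im := by simp
    have hre : (1 - conj ρ : ℂ).re = 1 - ρ.re := by simp
    have him0 : ρ.im ≠ 0 := by
      intro h0; rw [h0, zero_sub, abs_neg] at hnear; linarith
    have h01 := re_mem_Ioo_of_riemannZeta_eq_zero_of_im_ne_zero hz him0
    refine ⟨riemannZeta_one_sub_conj_eq_zero hz h01.1 h01.2, by rw [hre]; linarith, ?_⟩
    rw [him]; exact hnear
  · left
    rw [hmem]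
    exact ⟨hz, hgt, hnear⟩

/-- `log c(n, τ₀) = -n - (n+1) log(250(τ₀+1))`. -/
theorem Companion.log_turanConst (n : ℕ) {τ₀ : ℝ} (hτ₀ : 0 ≤ τ₀) :
    Real.log (turanConst n τ₀) = -n - (n + 1) * Real.log (250 * (τ₀ + 1)) := by
  unfold turanConst
  have h1 : (0 : ℝ) < 250 * (τ₀ + 1) := by linarith
  rw [Real.log_mul (Real.exp_pos _).ne' (by positivity), Real.log_exp, Real.log_inv,
    Real.log_pow]
  push_cast
  ring

set_option maxHeartbeats 800000 in
/-- **T39 (the price of a companion).**  See the module docstring. -/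
theorem companion_window {η : ℝ} (hη : 0 < η) (M K q : ℕ) (hq : 2 ≤ q)
    (hK : 1 ≤ K) {a γ₀ : ℝ} (ha : 5 / 2 ≤ a) (hγ : 2 * π * (M + 1) * K ≤ |γ₀|)
    (hK2 : Real.exp a * (2 * combL q / (π * K) ^ (q - 2)) ^ 2 ≤ combC ^ 2)
    (hε : 2 * combL q / (π ^ q * K ^ (q - 1)) ≤ 1 / 4)
    (hK1 : 2 * (2 * combL q / (π ^ q * K ^ (q - 1))) *
        (4 * π * zetaDensityConst * combC ^ 2 * (2 * ((2 * M + 1) * K) + 1) *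
          Real.log (|γ₀| + π * ((2 * M + 1) * K) + 2)) ≤ turanConst (M + 1) (2 * a - 3))
    (hcount : {ρ : ℂ | riemannZeta ρ = 0 ∧ 1 / 2 < ρ.re ∧
        |ρ.im - γ₀| < 2 * π * (M + 1) * K}.encard ≤ ((M + 1 : ℕ) : ℕ∞))
    (hE : 0 ≤ weilGroundEnergy a) (hζ : riemannZeta (1 / 2 + η + γ₀ * I) = 0) :
    η * (2 * a - 3) ≤
      Real.log (10 * π * zetaDensityConst * combC ^ 2 * (2 * ((2 * M + 1) * K) + 1) *
          Real.log (|γ₀| + π * ((2 * M + 1) * K) + 2)) +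
        (M + 1) + (M + 2) * Real.log (250 * (2 * a - 2)) := by
  classical
  -- constants
  set A₁ : ℝ := zetaDensityConst
  have hA₁ : 0 < A₁ := zetaDensityConst_pos
  have hC := combC_nonneg
  set ε : ℝ := 2 * combL q / (π ^ q * K ^ (q - 1)) with hε_def
  have hε0 : 0 ≤ ε := by
    rw [hε_def]; exact div_nonneg (by linarith [combL_nonneg q]) (by positivity)
  set JM : ℝ := (2 * M + 1) * K with hJM
  set LM : ℝ := Real.log (|γ₀| + π * JM + 2) with hLM
  set SM : ℝ := 4 * π * A₁ * combC ^ 2 * (2 * JM + 1) * LM with hSM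
  set cT : ℝ := turanConst (M + 1) (2 * a - 3) with hcT
  have hτ₀ : (0 : ℝ) ≤ 2 * a - 3 := by linarith
  have hcT0 : 0 < cT := turanConst_pos _ hτ₀
  have hKr : (1 : ℝ) ≤ K := by exact_mod_cast hK
  have hKpos : (0 : ℝ) < K := by linarith
  change 2 * ε * SM ≤ cT at hK1
  change η * (2 * a - 3) ≤ Real.log (10 * π * A₁ * combC ^ 2 * (2 * JM + 1) * LM) +
    (M + 1) + (M + 2) * Real.log (250 * (2 * a - 2))
  -- the finite set of right-of-the-line zone zeros
  set Z : Set ℂ := {ρ : ℂ | riemannZeta ρ = 0 ∧ 1 / 2 < ρ.re ∧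
    |ρ.im - γ₀| < 2 * π * (M + 1) * K} with hZ_def
  have hfin : Z.Finite := Set.finite_of_encard_le_coe hcount
  set Pmax : Finset ℂ := hfin.toFinset with hPmax
  have hmemP : ∀ ρ, ρ ∈ Pmax ↔ riemannZeta ρ = 0 ∧ 1 / 2 < ρ.re ∧
      |ρ.im - γ₀| < 2 * π * (M + 1) * K := fun ρ ↦ by rw [hPmax, hfin.mem_toFinset]; rfl
  set ρ₀ : ℂ := 1 / 2 + η + γ₀ * I with hρ₀
  have hρ₀re : ρ₀.re = 1 / 2 + η := by simp [hρ₀]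
  have hρ₀im : ρ₀.im = γ₀ := by simp [hρ₀]
  have hρ₀P : ρ₀ ∈ Pmax := by
    rw [hmemP]; refine ⟨hζ, by rw [hρ₀re]; linarith, ?_⟩
    rw [hρ₀im, sub_self, abs_zero]; positivity
  have hcardP : Pmax.card ≤ M + 1 := by
    have h := hfin.encard_eq_coe_toFinset_card
    rw [h] at hcount
    exact_mod_cast hcount
  -- shell pigeonhole on the companions
  obtain ⟨i, hiM, hshell⟩ := exists_free_shell (Pmax.erase ρ₀) (M := M)
    (by rw [Finset.card_erase_of_mem hρ₀P]; omega) γ₀ hKpos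
  have hiMr : (i : ℝ) ≤ M := by exact_mod_cast hiM
  set J : ℕ := (2 * i + 1) * K with hJ
  have hJr : (J : ℝ) = (2 * i + 1) * K := by rw [hJ]; push_cast; ring
  have hKJ : K ≤ J := by rw [hJ]; exact Nat.le_mul_of_pos_left K (by omega)
  have hiK : (i : ℝ) * K ≤ M * K := mul_le_mul_of_nonneg_right hiMr hKpos.le
  have hJJM : (J : ℝ) ≤ JM := by rw [hJr, hJM]; linarith
  have hcore : ∀ ρ ∈ Pmax, |ρ.im - γ₀| < π * (J + K) → |ρ.im - γ₀| ≤ π * (J - K) := by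
    intro ρ hρ hnear
    rw [hJr] at hnear ⊢
    by_cases h0 : ρ = ρ₀
    · rw [h0, hρ₀im, sub_self, abs_zero]
      have : (0 : ℝ) ≤ π * (2 * i * K) := by positivity
      linarith
    · rcases hshell ρ (Finset.mem_erase.mpr ⟨h0, hρ⟩) with h | h
      · linarith
      · linarith
  -- the core set `P` and the zone of `J`
  have hPzone : π * ((J : ℝ) + K) ≤ 2 * π * (M + 1) * K := by
    rw [hJr]; have := mul_le_mul_of_nonneg_left hiK Real.pi_pos.le; linarith
  have hγJ : π * ((J : ℝ) + K) ≤ |γ₀| := hPzone.trans hγ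
  set P : Finset ℂ := Pmax.filter (fun ρ ↦ |ρ.im - γ₀| < π * (J + K)) with hP_def
  have hmem : ∀ ρ, ρ ∈ P ↔ riemannZeta ρ = 0 ∧ 1 / 2 < ρ.re ∧ |ρ.im - γ₀| < π * (J + K) := by
    intro ρ
    rw [hP_def, Finset.mem_filter, hmemP]
    constructor
    · rintro ⟨⟨hz, hre, -⟩, hnear⟩; exact ⟨hz, hre, hnear⟩
    · rintro ⟨hz, hre, hnear⟩; exact ⟨⟨hz, hre, by linarith⟩, hnear⟩
  have hρ₀mem : ρ₀ ∈ P := by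
    rw [hmem]; refine ⟨hζ, by rw [hρ₀re]; linarith, ?_⟩
    rw [hρ₀im, sub_self, abs_zero]; positivity
  have hPsub : P ⊆ Pmax := Finset.filter_subset _ _
  have hP : ∀ ρ ∈ P, riemannZeta ρ = 0 ∧ 1 / 2 < ρ.re ∧ |ρ.im - γ₀| < π * (J + K) :=
    fun ρ hρ ↦ (hmem ρ).mp hρ
  have hP' : ∀ ρ ∈ P, riemannZeta ρ = 0 ∧ 1 / 2 < ρ.re ∧ ρ.re < 1 ∧ ρ.im ≠ 0 := by
    intro ρ hρ
    obtain ⟨hz, hre, hnear⟩ := hP ρ hρ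
    refine ⟨hz, hre, re_lt_one_of_riemannZeta_eq_zero hz, ?_⟩
    intro h0; rw [h0, zero_sub, abs_neg] at hnear; linarith
  have hcomp := zone_complete hγJ hmem
  -- T39g: Weil positivity bounds the core exponential sum
  set Λ : ℂ → ℂ := fun ρ ↦ ρ - 1 / 2 - γ₀ * I with hΛ
  set Φ : ℂ → ℂ := fun ρ ↦ combXform J (Λ ρ) with hΦ
  set m : ℂ → ℝ := fun ρ ↦ (riemannZetaZeroOrder ρ : ℝ) with hm
  set L : ℝ := Real.log (|γ₀| + π * J + 2) with hL
  have hUle : ∀ τ : ℝ, 2 ≤ τ → τ ≤ 2 * a - 2 →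
      ‖∑ ρ ∈ P, (m ρ : ℂ) * (Φ ρ ^ 2 * cexp (Λ ρ * τ))‖ ≤
        20 * π * A₁ * combC ^ 2 * (2 * J + 1) * L := fun τ h1 h2 ↦
    norm_combExpSum_le hq hK (by linarith) hγJ hK2 P hP hcomp hE h1 h2
  -- flatness on the core
  have hflat : ∀ ρ ∈ P, ‖Φ ρ - 2‖ ≤ ε := by
    intro ρ hρ
    obtain ⟨_, hre, h1, _⟩ := hP' ρ hρ
    have hc := hcore ρ (hPsub hρ) (hP ρ hρ).2.2
    refine norm_combXform_sub_two_le hq hK hKJ ?_ ?_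
    · rw [show (Λ ρ).re = ρ.re - 1 / 2 by simp [hΛ], abs_le]; constructor <;> linarith
    · rw [show (Λ ρ).im = ρ.im - γ₀ by simp [hΛ]]; exact hc
  have hmult : ∀ ρ ∈ P, Φ ρ ≠ 0 ∧ 3 ≤ ‖Φ ρ‖ ^ 2 ∧
      ‖Φ ρ ^ 2 / ((‖Φ ρ‖ ^ 2 : ℝ) : ℂ) - 1‖ ≤ 2 * ε := fun ρ hρ ↦
    flat_multiplier (hflat ρ hρ) hε
  -- the size of the weights
  have hS : ∑ ρ ∈ P, m ρ * ‖Φ ρ‖ ^ 2 ≤ 4 * π * A₁ * combC ^ 2 * (2 * J + 1) * L :=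
    sum_norm_sq_combXform_le γ₀ J P fun ρ hρ ↦
      ⟨(hP' ρ hρ).1, by linarith [(hP' ρ hρ).2.1], (hP' ρ hρ).2.2.1.le, (hP' ρ hρ).2.2.2⟩
  -- monotonicity `J ≤ J_M`
  have hL0 : 0 < L := Real.log_pos (by nlinarith [abs_nonneg γ₀, Real.pi_pos, (Nat.cast_nonneg J : (0:ℝ) ≤ J)])
  have hLLM : L ≤ LM := Real.log_le_log (by positivity) (by nlinarith [Real.pi_pos])
  have hmono : (2 * (J : ℝ) + 1) * L ≤ (2 * JM + 1) * LM :=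
    mul_le_mul (by linarith) hLLM hL0.le (by nlinarith)
  have hSSM : ∑ ρ ∈ P, m ρ * ‖Φ ρ‖ ^ 2 ≤ SM := by
    refine hS.trans ?_
    have : 0 ≤ 4 * π * A₁ * combC ^ 2 := by positivity
    calc 4 * π * A₁ * combC ^ 2 * (2 * J + 1) * L = 4 * π * A₁ * combC ^ 2 * ((2 * J + 1) * L) := by
          ring
      _ ≤ 4 * π * A₁ * combC ^ 2 * ((2 * JM + 1) * LM) := by gcongr
      _ = SM := by rw [hSM]; ring
  -- Turán visibility on the core
  obtain ⟨j₀, hj₀, hmax⟩ := Finset.exists_max_image P (fun ρ ↦ ρ.re) ⟨ρ₀, hρ₀mem⟩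
  set b : ℂ → ℝ := fun ρ ↦ m ρ * ‖Φ ρ‖ ^ 2 with hb
  set w : ℂ → ℂ := fun ρ ↦ Φ ρ ^ 2 / ((‖Φ ρ‖ ^ 2 : ℝ) : ℂ) with hw
  have hm0 : ∀ ρ ∈ P, 0 ≤ m ρ := fun ρ hρ ↦ riemannZetaZeroOrder_nonneg_of_zero (hP ρ hρ).1
  have hb0 : ∀ ρ ∈ P, 0 ≤ b ρ := fun ρ hρ ↦ mul_nonneg (hm0 ρ hρ) (by positivity)
  have hmax' : ∀ ρ ∈ P, (Λ ρ).re ≤ (Λ j₀).re := by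
    intro ρ hρ
    simp only [hΛ, sub_re]
    linarith [hmax ρ hρ]
  obtain ⟨τ, hτ, hT⟩ := exists_norm_expSum_ge_of_weights P Λ b hb0 hj₀ hmax' hτ₀ w
    (fun ρ hρ ↦ (hmult ρ hρ).2.2)
  -- identify the Turán sum with `U(τ)`
  have hident : ∑ ρ ∈ P, (b ρ : ℂ) * w ρ * cexp (Λ ρ * τ) =
      ∑ ρ ∈ P, (m ρ : ℂ) * (Φ ρ ^ 2 * cexp (Λ ρ * τ)) := by
    refine Finset.sum_congr rfl fun ρ hρ ↦ ?_
    have h2 : (((‖Φ ρ‖ ^ 2 : ℝ)) : ℂ) ≠ 0 := by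
      exact_mod_cast (pow_pos (norm_pos_iff.mpr (hmult ρ hρ).1) 2).ne'
    simp only [hb, hw, Complex.ofReal_mul]
    rw [mul_assoc (m ρ : ℂ), mul_div_assoc', mul_div_cancel_left₀ _ h2, mul_assoc]
  rw [hident] at hT
  have hτ1 : 2 ≤ τ := by linarith [hτ.1]
  have hτ2 : τ ≤ 2 * a - 2 := by linarith [hτ.2]
  have hkey := hT.trans (hUle τ hτ1 hτ2)
  -- lower bound of the Turán coefficient
  have hcard : P.card ≤ M + 1 := (Finset.card_le_card hPsub).trans hcardP
  have hcn : cT ≤ turanConst P.card (2 * a - 3) := turanConst_anti hcard hτ₀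
  have hbj₀ : 3 ≤ b j₀ := by
    have hz := (hP j₀ hj₀).1
    have hm1 : (1 : ℝ) ≤ m j₀ := by
      have := (riemannZetaZeroOrder_pos_iff (ne_one_of_riemannZeta_eq_zero hz)).mpr hz
      simp only [hm]; exact_mod_cast this
    have := (hmult j₀ hj₀).2.1
    simp only [hb]; nlinarith
  have hcoef : 2 * cT ≤ b j₀ * turanConst P.card (2 * a - 3) - 2 * ε * ∑ ρ ∈ P, b ρ := by
    have h1 : 3 * cT ≤ b j₀ * turanConst P.card (2 * a - 3) :=
      mul_le_mul hbj₀ hcn hcT0.le (by linarith)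
    have h2 : 2 * ε * ∑ ρ ∈ P, b ρ ≤ cT := by
      refine le_trans ?_ hK1
      exact mul_le_mul_of_nonneg_left hSSM (by positivity)
    linarith
  have hexpη : Real.exp (η * (2 * a - 3)) ≤ Real.exp ((Λ j₀).re * τ) := by
    rw [Real.exp_le_exp]
    have h1 : η ≤ (Λ j₀).re := by
      have := hmax ρ₀ hρ₀mem
      simp only [hΛ, sub_re, Complex.mul_re, Complex.I_re, Complex.I_im, Complex.ofReal_re,
        Complex.ofReal_im]
      rw [hρ₀re] at this
      norm_num; linarith
    have h0 : 0 ≤ (Λ j₀).re := hη.le.trans h1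
    calc η * (2 * a - 3) ≤ (Λ j₀).re * (2 * a - 3) := by nlinarith
      _ ≤ (Λ j₀).re * τ := mul_le_mul_of_nonneg_left hτ.1 h0
  have hfinal : 2 * cT * Real.exp (η * (2 * a - 3)) ≤
      20 * π * A₁ * combC ^ 2 * (2 * JM + 1) * LM := by
    have h20 : 20 * π * A₁ * combC ^ 2 * (2 * J + 1) * L ≤
        20 * π * A₁ * combC ^ 2 * (2 * JM + 1) * LM := by
      have : 0 ≤ 20 * π * A₁ * combC ^ 2 := by positivity
      calc 20 * π * A₁ * combC ^ 2 * (2 * J + 1) * L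
          = 20 * π * A₁ * combC ^ 2 * ((2 * J + 1) * L) := by ring
        _ ≤ 20 * π * A₁ * combC ^ 2 * ((2 * JM + 1) * LM) := by gcongr
        _ = _ := by ring
    calc 2 * cT * Real.exp (η * (2 * a - 3))
        ≤ (b j₀ * turanConst P.card (2 * a - 3) - 2 * ε * ∑ ρ ∈ P, b ρ) *
            Real.exp ((Λ j₀).re * τ) :=
          mul_le_mul hcoef hexpη (Real.exp_pos _).le (by linarith)
      _ ≤ _ := hkey.trans h20
  -- take logarithms
  set B10 : ℝ := 10 * π * A₁ * combC ^ 2 * (2 * JM + 1) * LM with hB10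
  have hexple : Real.exp (η * (2 * a - 3)) ≤ B10 / cT := by
    rw [le_div_iff₀ hcT0]; linarith
  rcases le_or_gt B10 0 with hB | hB
  · exfalso
    have : B10 / cT ≤ 0 := div_nonpos_of_nonpos_of_nonneg hB hcT0.le
    linarith [Real.exp_pos (η * (2 * a - 3))]
  have hlog := Real.log_le_log (Real.exp_pos _) hexple
  rw [Real.log_exp, Real.log_div hB.ne' hcT0.ne', hcT, log_turanConst _ hτ₀] at hlog
  have e : (2 * a - 3 + 1 : ℝ) = 2 * a - 2 := by ring
  rw [e] at hlog
  push_cast at hlog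
  linarith

/-- **T39, contrapositive (exclusion with priced companions).**  Under the parameter conditions
of `companion_window`, if the window inequality fails then either the companion count exceeds
`M + 1` or `ζ(½ + η + iγ₀) ≠ 0`. -/
theorem riemannZeta_ne_zero_of_companions {η : ℝ} (hη : 0 < η) (M K q : ℕ)
    (hq : 2 ≤ q) (hK : 1 ≤ K) {a γ₀ : ℝ} (ha : 5 / 2 ≤ a) (hγ : 2 * π * (M + 1) * K ≤ |γ₀|)
    (hK2 : Real.exp a * (2 * combL q / (π * K) ^ (q - 2)) ^ 2 ≤ combC ^ 2)
    (hε : 2 * combL q / (π ^ q * K ^ (q - 1)) ≤ 1 / 4)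
    (hK1 : 2 * (2 * combL q / (π ^ q * K ^ (q - 1))) *
        (4 * π * zetaDensityConst * combC ^ 2 * (2 * ((2 * M + 1) * K) + 1) *
          Real.log (|γ₀| + π * ((2 * M + 1) * K) + 2)) ≤ turanConst (M + 1) (2 * a - 3))
    (hcount : {ρ : ℂ | riemannZeta ρ = 0 ∧ 1 / 2 < ρ.re ∧
        |ρ.im - γ₀| < 2 * π * (M + 1) * K}.encard ≤ ((M + 1 : ℕ) : ℕ∞))
    (hE : 0 ≤ weilGroundEnergy a)
    (hwin : Real.log (10 * π * zetaDensityConst * combC ^ 2 * (2 * ((2 * M + 1) * K) + 1) *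
          Real.log (|γ₀| + π * ((2 * M + 1) * K) + 2)) +
        (M + 1) + (M + 2) * Real.log (250 * (2 * a - 2)) < η * (2 * a - 3)) :
    riemannZeta (1 / 2 + η + γ₀ * I) ≠ 0 := fun hζ ↦
  absurd (companion_window hη M K q hq hK ha hγ hK2 hε hK1 hcount hE hζ) (not_le.mpr hwin)

end Summit.RiemannHypothesis.RiemannHypothesis.Theorems
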